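import Summits.MatrixMultiplication.MatrixMultiplication.Theses.DeterminantalIdealExponent
import Summits.MatrixMultiplication.MatrixMultiplication.Theses.HiddenToeplitzCorners
import Summits.MatrixMultiplication.MatrixMultiplication.Theorems.HiddenToeplitzCornersCostGlue
import Summits.MatrixMultiplication.MatrixMultiplication.Theorems.HiddenToeplitzCornersToeplitzLikeDetCost

/-!
# Crux `CheapIdealMember` (stmt-MatrixMultiplication-7708) — `Lines/birth.lean`, the BC3 birth skeleton

Route `DeterminantalIdealExponent` (route-MatrixMultiplication-DeterminantalIdealExponent; deciding theorem
`closes : AndrewsLifting → CheapIdealMember → MatrixMultiplication`, proved in the route file by Bini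
bookkeeping).  The crux is the route's thesis `X` ("some cheap polynomial knows rank"):

  `CheapIdealMember : ∀ ε > 0, ∃ᶠ r, ∃ g ≠ 0, complexity (g · det X_r) ≤ r^(2+ε)`

(`complexity` = least size of a division-free fan-in-two `ArithCircuit`, `detPoly (Fin r) ℂ = det (X_ij)`).

## Where the tree stands (2026-08-17)

* `AndrewsLifting` is PROVED (`Theorems.andrewsLifting_proof`, Literature `Andrews2022_thm3_holds`), so the
  route decides `ω(ℂ) = 2` from this crux alone; conversely `ω(ℂ) = 2 →` crux through the support
  `FastDetMultiple` (true on paper, open in tree).  The crux is therefore summit-hard; a skeleton can only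
  redirect it to a STRUCTURED witness, and must say why the structure helps.
* The companion route `HiddenToeplitzCorners` supplies exactly that, and since 2026-08-16 its cost half is a
  THEOREM: `Theorems.ToeplitzLikeDetCost_of` (ω-free superfast elimination, division-free output form:
  every Toeplitz-like pencil `T(X) = Σ X_ab T_ab` of size `N ≤ r³` with split Stein generators of length `d`
  and sparsity `s` has a nonzero `Q` with `complexity (Q · det T(X)) ≤ (d²N + s)·r^ε`, eventually in `r`),
  together with the Nullstellensatz glue `Theorems.costGlue_det_dvd_of_vanish` (a polynomial vanishing on
  the singular matrices is divisible by `det X`, `detPoly_prime`).  What is OPEN is the construction: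
  a Toeplitz-like pencil, generically nonsingular, singular on every singular `X`, inside the budget.
* The route header's TWO-LAYER PLAN for this crux ("CheapIdealMember ⇐ a construction crux from a companion
  route (the hidden-corner thesis) → its cost lemma → CheapIdealMember") has thus collapsed to ONE open
  piece, the companion crux `HiddenCorners` (stmt-7492) — whose own registered birth skeleton
  (`Cruxes/HiddenCorners/Lines/birth.lean`, idea `entangled-adjugate-corners`, triage pass ×3; the frame
  lines `Sketch`/`ApolarSketch` are dead) is the one live constructive plan on this summit for cheap ideal
  members.  This skeleton is that plan RE-CUT IN THE DIE CURRENCY (total cost `d²N + s`, not the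
  HiddenCorners shape `N ≤ r^(2+ε)`, `d ≤ r^ε`), composed all the way down to `CheapIdealMember` by name.

## The line: a structured determinantal witness with an ENTANGLED ADJUGATE certificate

A nonzero `f ∈ (det X_r)` of cost `r^(2+ε)` is produced as `f := Q · det T(X)` where `T` is a Toeplitz-like
pencil with `d²N + s ≤ r^(2+ε/2)` whose singularity on `{det X = 0}` is CERTIFIED by a constant
`K : ℂ^(r×r) → ℂ^N`, injective on the Segre cone `{v wᵀ}`, with `T(X) · K · vec(adj X) = 0` for singular `X`
(a kernel map of `X`-degree `r − 1`; every no-go on record — `HiddenCornerLemmaR` stmt-10752, the window /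
hull / Flanders counts, the conjectured law of ends `Cruxes/HiddenCorners/LawOfEnds.lean` — concerns the
degree-1 device `T(X)E = FX`).  Three stubs, all load-bearing in `CheapIdealMember_of_stubs` / `CheapIdealMember_of`:

* `stub_corank_one_step`  (M, provable now; VERBATIM the stub of the same name in
  `Cruxes/HiddenCorners/Lines/birth.lean`, so one proof closes both) — on the stratum `rank X = r − 1`,
  `adj X = v wᵀ ≠ 0` with `Xv = 0`, `wᵀX = 0`, so `K · vec(adj X) ≠ 0` is a kernel vector of `T(X)`:
  `det T(X) = 0` there.
* `stub_corank_one_dense` (M, provable now; VERBATIM shared likewise) — for a linear pencil, vanishing of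
  `det T(X)` on the corank-one stratum forces vanishing on all singular `X` (rank normal form: a singular
  `X` of rank `k ≤ r − 2` is `lim_{t→0} (X + tY)` with `rank (X + tY) = r − 1`; `t ↦ det T(X + tY)` is a
  polynomial).
* `stub_adjugate_witness` (XL / OPEN — the bet) — for every `ε > 0`, frequently in `r`: a Toeplitz-like
  pencil with `N ≤ r³` and `d²N + s ≤ r^(2+ε)`, nonsingular at some `X₀`, carrying a Segre-injective `K`
  with `T(X) · K · vec(adj X) = 0` on `{det X = 0}`.  WHY EASIER than the crux: the search space is cut from
  "all circuits of size r^(2+ε)" to one explicit finite-dimensional question per `r` — for FIXED `K` the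
  kernel identity is LINEAR in the placement `T`, it holds identically for the natural adjugate pencils
  `M ↦ Σ_k A_k X M B_k + C_k M X D_k` (`N = r²`, budget met with the whole `r^ε` slack unused), and what
  remains is the displacement structure of such a family up to constant equivalence `P · T(X) · Q`
  (card `entangled-adjugate-corners`, §Transfer); refutable by exact linear algebra at `r ∈ {4, 5}`.

`CheapIdealMember_of_stubs : <stub₁-sig> → <stub₂-sig> → <stub₃-sig> → CheapIdealMember` is a REAL proof
(no `sorry`; axioms `propext`, `Classical.choice`, `Quot.sound`): stubs 1+2 give clause (iii);
`ToeplitzLikeDetCost_of` at `ε/2` gives `Q ≠ 0` with `complexity (Q · det T(X)) ≤ (d²N + s)·r^(ε/2) ≤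
r^(2+ε/2)·r^(ε/2) = r^(2+ε)`; `det T(X) ≠ 0` by evaluation at `X₀` (`costGlue_eval_pencil_det`);
`det X ∣ det T(X)` by the Nullstellensatz (`costGlue_det_dvd_of_vanish`); the cofactor `g` with
`Q · det T(X) = det X · g` is the witness (`g ≠ 0` since `ℂ[X]` is a domain).
`CheapIdealMember_of : CheapIdealMember` feeds it the three declared stubs (the crux BY NAME, closed only through
their `sorry`s; it is the theorem `ledger skeleton check` registers — the checker admits hypotheses only as named
obligations, hence the explicit-signature form carries the suffix `_of_stubs`, as in `Cruxes/CommutativeRealization`).  Two sorry-free remarks close the file: `adjugate_witness_of_family` (the open stub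
`stub_adjugate_family` of `HiddenCorners/birth` IMPLIES `stub_adjugate_witness` — the converse fails, the
DIE budget also admits `N = r^(1+ε)`, `d ≈ r^(1/2)`, which a polynomial law of ends `r ≤ c·(d+1)^k` kills
only for `k = 1`, whereas it kills the HiddenCorners budget for every `k`; `LawOfEnds.splitNeutralLaw_refutes`)
and `cheapIdealMember_iff_cheapIdealMembers` (this crux = the companion's open support `CheapIdealMembers`,
stmt-7497, by `det X ≠ 0` in the domain `ℂ[X]`).

Honest status.  Stub 3 carries the whole open content (as any sufficient condition for an `ω = 2`-equivalent
crux must); it is NOT cheaply the crux or the summit — reaching either needs stubs 1–2 (not in tree), the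
17-file theorem `ToeplitzLikeDetCost_of` and the Nullstellensatz glue (BC3 probes, `Lines/birth.md`: all six
`stub → CheapIdealMember` / `stub → MatrixMultiplication` probes FAIL).  Every census on the companion crux
(frames at `δ = 2`, honest Hankel, degree-≤2 kernel data, `r = 3`, `N ≤ 12–20`) is negative; the first live
arena recorded there is `δ ≥ 4`, `r ∈ {4, 5}` with cancelling (non-monomial) placements.
Disproof used: none exists — `ledger crux ls stmt-MatrixMultiplication-7708` has no workfiles before this one
(no `Disproof.lean`, no `Negative/`); `ledger negatives --problem MatrixMultiplication` = 7 entries, none on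
determinantal ideals / pencils / circuit size; honoured instead: the refuted sibling `HiddenCornerLemma`
stmt-7493 (singular witness `(r,N,d) = (3,9,1)`) — generic nonsingularity `det T(X₀) ≠ 0` is an explicit
clause of stub 3 — and the proved bridge `LawOfEnds.splitNeutralLaw_refutes` (law itself open), see above.
-/

set_option linter.dupNamespace false

namespace Summit.MatrixMultiplication.MatrixMultiplication.Cruxes.CheapIdealMember.Birth

open scoped BigOperators Matrix
open Filter
open Literature.Computability.AlgebraicComplexity (complexity detPoly)
open Summit.MatrixMultiplication.MatrixMultiplication.Theses.DeterminantalIdealExponent (CheapIdealMember)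
open Summit.MatrixMultiplication.MatrixMultiplication.Theses.HiddenToeplitzCorners
  (ToeplitzLikeDetCost HiddenCorners CheapIdealMembers)
open Summit.MatrixMultiplication.MatrixMultiplication.Theorems
  (costGlue_eval_pencil_det costGlue_det_dvd_of_vanish costGlue_cost_arith ToeplitzLikeDetCost_of)

/-! ## The three registered stubs -/

/-- **STUB 1 — corank-one step of the adjugate corner criterion** (M, provable now; character for
character the stub of the same name in `Cruxes/HiddenCorners/Lines/birth.lean`).  If `K` is injective on
the Segre cone and `T(X) · (K · vec(adj X)) = 0` for every singular `X`, then `det T(X) = 0` for every `X`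
of rank exactly `r - 1`: there `adj X = v wᵀ ≠ 0` (`X v = 0`, `wᵀ X = 0`; `r = 1`: `adj X = 1`), so
`K · vec(adj X) ≠ 0` lies in the kernel of `T(X)` (`N = 0` makes the Segre hypothesis false, `r = 0` the
rank hypothesis).  Leans on Mathlib `Matrix.adjugate`, `Matrix.mul_adjugate`, `Matrix.rank`,
`Matrix.exists_mulVec_eq_zero_iff`; the link "rank `r − 1` ⇒ adjugate nonzero of rank one" is a short
minors argument.  Sources: card `entangled-adjugate-corners` (First lemma), Dieudonne1948, Flanders1962. -/
theorem stub_corank_one_step :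
    ∀ (r N : ℕ) (T : Fin r → Fin r → Matrix (Fin N) (Fin N) ℂ) (K : Matrix (Fin N) (Fin r × Fin r) ℂ),
      (∀ v w : Fin r → ℂ, v ≠ 0 → w ≠ 0 →
        Matrix.mulVec K (fun p : Fin r × Fin r => v p.1 * w p.2) ≠ 0) →
      (∀ X : Matrix (Fin r) (Fin r) ℂ, X.det = 0 →
        Matrix.mulVec (∑ a : Fin r, ∑ b : Fin r, X a b • T a b)
          (Matrix.mulVec K fun p : Fin r × Fin r => X.adjugate p.1 p.2) = 0) →
      ∀ X : Matrix (Fin r) (Fin r) ℂ, X.rank + 1 = r →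
        (∑ a : Fin r, ∑ b : Fin r, X a b • T a b).det = 0 := by
  sorry

/-- **STUB 2 — density of the corank-one stratum, pencil form** (M, provable now; character for character
the stub of the same name in `Cruxes/HiddenCorners/Lines/birth.lean`).  If `X ↦ det T(X)` vanishes on every
`X` with `rank X + 1 = r` it vanishes on every singular `X`: write a singular `X` of rank `k ≤ r − 2` as
`P · diag(1^k, 0) · Q` and put `Y := P · diag(0^k, 1^(r−k−1), 0) · Q`; then `rank (X + tY) = r − 1` for
`t ≠ 0`, so the polynomial `t ↦ det T(X + tY)` vanishes on `t ≠ 0`, hence at `t = 0` (`r = 0`: the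
conclusion is vacuous, `det` of the empty matrix is `1`; `r = 1`: `X = 0` has rank `0 = r − 1`).  Leans on
Mathlib `Matrix.rank`, rank normal form / `Matrix.exists_list_transvec_mul_mul_list_transvec_eq_diagonal`-type
factorisations, `Polynomial` identity (infinitely many roots).  Sources: card `entangled-adjugate-corners`,
EisenbudHarris1988 (corank strata of determinantal varieties). -/
theorem stub_corank_one_dense :
    ∀ (r N : ℕ) (T : Fin r → Fin r → Matrix (Fin N) (Fin N) ℂ),
      (∀ X : Matrix (Fin r) (Fin r) ℂ, X.rank + 1 = r →
        (∑ a : Fin r, ∑ b : Fin r, X a b • T a b).det = 0) →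
      ∀ X : Matrix (Fin r) (Fin r) ℂ, X.det = 0 →
        (∑ a : Fin r, ∑ b : Fin r, X a b • T a b).det = 0 := by
  sorry

/-- **STUB 3 — the structured adjugate witness, in the DIE cost currency** (XL / OPEN — the line's bet).
For every `ε > 0` and frequently in `r`: a pencil `T : M_r(ℂ) → M_N(ℂ)`, `N ≤ r³`, with split Stein
generators `T_ab − Z T_ab Zᵀ = G₀ (H₁)_abᵀ + (G₁)_ab H₀ᵀ` of length `d` and total generator sparsity `s`
satisfying the TOTAL-COST budget `d²N + s ≤ r^(2+ε)` (the bound of `ToeplitzLikeDetCost`, proved), nonsingular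
at some `X₀`, together with a Segre-injective `K : ℂ^(r×r) → ℂ^N` such that `K · vec(adj X)` is a kernel
vector of `T(X)` for every singular `X`.  Weaker than `stub_adjugate_family` of `HiddenCorners/birth`
(`adjugate_witness_of_family` below); why plausibly attackable and why it might fail: see the module
docstring (linear in `T` for fixed `K`; natural adjugate pencils satisfy the kernel identity at `N = r²`;
all censuses at `r = 3` negative; a `k = 1` law of ends would refute it).  Sources: card
`entangled-adjugate-corners` (stmt-7492 Ideas), KailathKungMorf1979, HeinigRost1984, Pan2001 (Cor. 5.3.3),
Andrews2022 (arXiv:2208.01078, Thm 3), EisenbudHarris1988, arXiv:1002.1732. -/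
theorem stub_adjugate_witness :
    ∀ ε : ℝ, 0 < ε → ∃ᶠ r : ℕ in Filter.atTop, ∃ (N d : ℕ), N ≤ r ^ 3 ∧
      ∃ (T : Fin r → Fin r → Matrix (Fin N) (Fin N) ℂ) (G₀ H₀ : Matrix (Fin N) (Fin d) ℂ)
        (G₁ H₁ : Fin r → Fin r → Matrix (Fin N) (Fin d) ℂ),
        (∀ a b, T a b - (Matrix.of fun i j : Fin N => if (i : ℕ) = (j : ℕ) + 1 then (1 : ℂ) else 0) * T a b *
            (Matrix.of fun i j : Fin N => if (i : ℕ) = (j : ℕ) + 1 then (1 : ℂ) else 0)ᵀ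
              = G₀ * (H₁ a b)ᵀ + G₁ a b * H₀ᵀ) ∧
        (d : ℝ) ^ 2 * (N : ℝ) +
            ((∑ a : Fin r, ∑ b : Fin r,
              ((Finset.univ.filter fun p : Fin N × Fin d => G₁ a b p.1 p.2 ≠ 0).card +
                (Finset.univ.filter fun p : Fin N × Fin d => H₁ a b p.1 p.2 ≠ 0).card) : ℕ) : ℝ)
          ≤ (r : ℝ) ^ (2 + ε) ∧
        (∃ X₀ : Matrix (Fin r) (Fin r) ℂ, (∑ a : Fin r, ∑ b : Fin r, X₀ a b • T a b).det ≠ 0) ∧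
        ∃ K : Matrix (Fin N) (Fin r × Fin r) ℂ,
          (∀ v w : Fin r → ℂ, v ≠ 0 → w ≠ 0 →
            Matrix.mulVec K (fun p : Fin r × Fin r => v p.1 * w p.2) ≠ 0) ∧
          ∀ X : Matrix (Fin r) (Fin r) ℂ, X.det = 0 →
            Matrix.mulVec (∑ a : Fin r, ∑ b : Fin r, X a b • T a b)
              (Matrix.mulVec K fun p : Fin r × Fin r => X.adjugate p.1 p.2) = 0 := by
  sorry

/-! ## The composition: the three stub statements prove the crux BY NAME -/

/-- **THE SKELETON THEOREM (explicit-hypothesis form).** The crux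
`Summit.MatrixMultiplication.MatrixMultiplication.Theses.DeterminantalIdealExponent.CheapIdealMember`
(stmt-MatrixMultiplication-7708) from the three stub STATEMENTS as hypotheses: clause (iii) from the
certificate (stubs 1, 2), a cheap nonzero multiple `Q · det T(X)` from ω-free superfast elimination
(`ToeplitzLikeDetCost_of`, PROVED) at `ε/2`, nonvanishing by evaluation at `X₀`, divisibility by `det X` by
the Nullstellensatz for the prime `(det X)`, and the cofactor as witness; cost
`(d²N + s)·r^(ε/2) ≤ r^(2+ε/2)·r^(ε/2) = r^(2+ε)`.  Sorry-free; standard axioms. [folklore] -/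
theorem CheapIdealMember_of_stubs :
    (∀ (r N : ℕ) (T : Fin r → Fin r → Matrix (Fin N) (Fin N) ℂ) (K : Matrix (Fin N) (Fin r × Fin r) ℂ),
      (∀ v w : Fin r → ℂ, v ≠ 0 → w ≠ 0 →
        Matrix.mulVec K (fun p : Fin r × Fin r => v p.1 * w p.2) ≠ 0) →
      (∀ X : Matrix (Fin r) (Fin r) ℂ, X.det = 0 →
        Matrix.mulVec (∑ a : Fin r, ∑ b : Fin r, X a b • T a b)
          (Matrix.mulVec K fun p : Fin r × Fin r => X.adjugate p.1 p.2) = 0) →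
      ∀ X : Matrix (Fin r) (Fin r) ℂ, X.rank + 1 = r →
        (∑ a : Fin r, ∑ b : Fin r, X a b • T a b).det = 0) →
    (∀ (r N : ℕ) (T : Fin r → Fin r → Matrix (Fin N) (Fin N) ℂ),
      (∀ X : Matrix (Fin r) (Fin r) ℂ, X.rank + 1 = r →
        (∑ a : Fin r, ∑ b : Fin r, X a b • T a b).det = 0) →
      ∀ X : Matrix (Fin r) (Fin r) ℂ, X.det = 0 →
        (∑ a : Fin r, ∑ b : Fin r, X a b • T a b).det = 0) →
    (∀ ε : ℝ, 0 < ε → ∃ᶠ r : ℕ in Filter.atTop, ∃ (N d : ℕ), N ≤ r ^ 3 ∧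
      ∃ (T : Fin r → Fin r → Matrix (Fin N) (Fin N) ℂ) (G₀ H₀ : Matrix (Fin N) (Fin d) ℂ)
        (G₁ H₁ : Fin r → Fin r → Matrix (Fin N) (Fin d) ℂ),
        (∀ a b, T a b - (Matrix.of fun i j : Fin N => if (i : ℕ) = (j : ℕ) + 1 then (1 : ℂ) else 0) * T a b *
            (Matrix.of fun i j : Fin N => if (i : ℕ) = (j : ℕ) + 1 then (1 : ℂ) else 0)ᵀ
              = G₀ * (H₁ a b)ᵀ + G₁ a b * H₀ᵀ) ∧
        (d : ℝ) ^ 2 * (N : ℝ) +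
            ((∑ a : Fin r, ∑ b : Fin r,
              ((Finset.univ.filter fun p : Fin N × Fin d => G₁ a b p.1 p.2 ≠ 0).card +
                (Finset.univ.filter fun p : Fin N × Fin d => H₁ a b p.1 p.2 ≠ 0).card) : ℕ) : ℝ)
          ≤ (r : ℝ) ^ (2 + ε) ∧
        (∃ X₀ : Matrix (Fin r) (Fin r) ℂ, (∑ a : Fin r, ∑ b : Fin r, X₀ a b • T a b).det ≠ 0) ∧
        ∃ K : Matrix (Fin N) (Fin r × Fin r) ℂ,
          (∀ v w : Fin r → ℂ, v ≠ 0 → w ≠ 0 →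
            Matrix.mulVec K (fun p : Fin r × Fin r => v p.1 * w p.2) ≠ 0) ∧
          ∀ X : Matrix (Fin r) (Fin r) ℂ, X.det = 0 →
            Matrix.mulVec (∑ a : Fin r, ∑ b : Fin r, X a b • T a b)
              (Matrix.mulVec K fun p : Fin r × Fin r => X.adjugate p.1 p.2) = 0) →
    CheapIdealMember := by
  intro h1 h2 h3 ε hε
  have hε2 : 0 < ε / 2 := by positivity
  have hW := h3 (ε / 2) hε2
  have hD := ToeplitzLikeDetCost_of (ε / 2) hε2
  have hr1 : ∀ᶠ r : ℕ in atTop, 1 ≤ r := eventually_ge_atTop 1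
  refine (hW.and_eventually (hD.and hr1)).mono ?_
  rintro r ⟨⟨N, d, hN3, T, G₀, H₀, G₁, H₁, hStein, hbudget, ⟨X₀, hX₀⟩, K, hK, hker⟩, hDr, hr1⟩
  -- clause (iii) — `T(X)` is singular whenever `X` is — from the entangled adjugate certificate
  have hsing : ∀ X : Matrix (Fin r) (Fin r) ℂ, X.det = 0 →
      (∑ a : Fin r, ∑ b : Fin r, X a b • T a b).det = 0 :=
    h2 r N T (h1 r N T K hK hker)
  -- ω-free superfast elimination (PROVED in the tree): a cheap nonzero multiple `Q · det T(X)`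
  obtain ⟨Q, hQ, hcost⟩ := hDr N d hN3 T G₀ H₀ G₁ H₁ hStein
  -- the pencil determinant as a polynomial: nonzero and divisible by `det X`
  have hdetP_ne : (∑ a : Fin r, ∑ b : Fin r,
      (MvPolynomial.X (a, b) : MvPolynomial (Fin r × Fin r) ℂ) •
        (T a b).map (MvPolynomial.C : ℂ → MvPolynomial (Fin r × Fin r) ℂ)).det ≠ 0 := by
    intro h
    apply hX₀
    have key := costGlue_eval_pencil_det T (fun p => X₀ p.1 p.2)
    rw [h, map_zero] at key
    exact key.symm
  have hr0 : 0 < r := hr1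
  have hdetP_dvd : (Matrix.mvPolynomialX (Fin r) (Fin r) ℂ).det ∣ (∑ a : Fin r, ∑ b : Fin r,
      (MvPolynomial.X (a, b) : MvPolynomial (Fin r × Fin r) ℂ) •
        (T a b).map (MvPolynomial.C : ℂ → MvPolynomial (Fin r × Fin r) ℂ)).det := by
    refine costGlue_det_dvd_of_vanish hr0 fun x hx => ?_
    rw [costGlue_eval_pencil_det]
    have := hsing (Matrix.of fun i j : Fin r => x (i, j)) hx
    simpa only [Matrix.of_apply] using this
  obtain ⟨g, hg⟩ := dvd_mul_of_dvd_right hdetP_dvd Q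
  refine ⟨g, ?_, ?_⟩
  · rintro rfl
    rw [mul_zero] at hg
    exact mul_ne_zero hQ hdetP_ne hg
  · have hgP : g * detPoly (Fin r) ℂ = Q * (∑ a : Fin r, ∑ b : Fin r,
        (MvPolynomial.X (a, b) : MvPolynomial (Fin r × Fin r) ℂ) •
          (T a b).map (MvPolynomial.C : ℂ → MvPolynomial (Fin r × Fin r) ℂ)).det := by
      rw [hg, mul_comm]
      rfl
    rw [hgP]
    refine hcost.trans ?_
    have hr1' : (1 : ℝ) ≤ (r : ℝ) := by exact_mod_cast hr1
    have hr0' : (0 : ℝ) < (r : ℝ) := by positivity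
    calc _ ≤ (r : ℝ) ^ (2 + ε / 2) * (r : ℝ) ^ (ε / 2) :=
          mul_le_mul_of_nonneg_right hbudget (by positivity)
      _ = (r : ℝ) ^ (2 + ε) := by
          rw [← Real.rpow_add hr0']
          congr 1
          ring

/-! ## Two sorry-free remarks: the link to the companion line, and the dedup of the target -/

/-- **LINK to the companion line.** The open stub `stub_adjugate_family` of the registered birth
skeleton of crux `HiddenCorners` (stmt-MatrixMultiplication-7492, `Cruxes/HiddenCorners/Lines/birth.lean`,
route `HiddenToeplitzCorners`; its statement is the hypothesis below, character for character) IMPLIES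
this line's open stub `stub_adjugate_witness`: the HiddenCorners budget `N ≤ r^(2+ε')`, `d ≤ r^ε'`,
`s ≤ r^(2+ε')` gives the DIE budget `d²N + s ≤ r^(2+ε)` for `ε' = min ε 1 / 8` and `r` large
(`costGlue_cost_arith`, in tree).  So any success on the companion line closes stub 3 here; the converse
fails (stub 3 also admits, e.g., `N = r^(1+ε)`, `d = r^(1/2)`, which no polynomial "law of ends"
`r ≤ c·(d+1)^k` with `k ≥ 2` excludes).  Sorry-free. [folklore] -/
theorem adjugate_witness_of_family :
    (∀ ε : ℝ, 0 < ε → ∃ᶠ r : ℕ in Filter.atTop, ∃ (N d : ℕ), (N : ℝ) ≤ (r : ℝ) ^ (2 + ε) ∧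
      (d : ℝ) ≤ (r : ℝ) ^ ε ∧
      ∃ (T : Fin r → Fin r → Matrix (Fin N) (Fin N) ℂ) (G₀ H₀ : Matrix (Fin N) (Fin d) ℂ)
        (G₁ H₁ : Fin r → Fin r → Matrix (Fin N) (Fin d) ℂ),
        (∀ a b, T a b - (Matrix.of fun i j : Fin N => if (i : ℕ) = (j : ℕ) + 1 then (1 : ℂ) else 0) * T a b *
            (Matrix.of fun i j : Fin N => if (i : ℕ) = (j : ℕ) + 1 then (1 : ℂ) else 0)ᵀ
              = G₀ * (H₁ a b)ᵀ + G₁ a b * H₀ᵀ) ∧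
        ((∑ a : Fin r, ∑ b : Fin r,
            ((Finset.univ.filter fun p : Fin N × Fin d => G₁ a b p.1 p.2 ≠ 0).card +
              (Finset.univ.filter fun p : Fin N × Fin d => H₁ a b p.1 p.2 ≠ 0).card) : ℕ) : ℝ)
            ≤ (r : ℝ) ^ (2 + ε) ∧
        (∃ X₀ : Matrix (Fin r) (Fin r) ℂ, (∑ a : Fin r, ∑ b : Fin r, X₀ a b • T a b).det ≠ 0) ∧
        ∃ K : Matrix (Fin N) (Fin r × Fin r) ℂ,
          (∀ v w : Fin r → ℂ, v ≠ 0 → w ≠ 0 →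
            Matrix.mulVec K (fun p : Fin r × Fin r => v p.1 * w p.2) ≠ 0) ∧
          ∀ X : Matrix (Fin r) (Fin r) ℂ, X.det = 0 →
            Matrix.mulVec (∑ a : Fin r, ∑ b : Fin r, X a b • T a b)
              (Matrix.mulVec K fun p : Fin r × Fin r => X.adjugate p.1 p.2) = 0) →
    (∀ ε : ℝ, 0 < ε → ∃ᶠ r : ℕ in Filter.atTop, ∃ (N d : ℕ), N ≤ r ^ 3 ∧
      ∃ (T : Fin r → Fin r → Matrix (Fin N) (Fin N) ℂ) (G₀ H₀ : Matrix (Fin N) (Fin d) ℂ)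
        (G₁ H₁ : Fin r → Fin r → Matrix (Fin N) (Fin d) ℂ),
        (∀ a b, T a b - (Matrix.of fun i j : Fin N => if (i : ℕ) = (j : ℕ) + 1 then (1 : ℂ) else 0) * T a b *
            (Matrix.of fun i j : Fin N => if (i : ℕ) = (j : ℕ) + 1 then (1 : ℂ) else 0)ᵀ
              = G₀ * (H₁ a b)ᵀ + G₁ a b * H₀ᵀ) ∧
        (d : ℝ) ^ 2 * (N : ℝ) +
            ((∑ a : Fin r, ∑ b : Fin r,
              ((Finset.univ.filter fun p : Fin N × Fin d => G₁ a b p.1 p.2 ≠ 0).card +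
                (Finset.univ.filter fun p : Fin N × Fin d => H₁ a b p.1 p.2 ≠ 0).card) : ℕ) : ℝ)
          ≤ (r : ℝ) ^ (2 + ε) ∧
        (∃ X₀ : Matrix (Fin r) (Fin r) ℂ, (∑ a : Fin r, ∑ b : Fin r, X₀ a b • T a b).det ≠ 0) ∧
        ∃ K : Matrix (Fin N) (Fin r × Fin r) ℂ,
          (∀ v w : Fin r → ℂ, v ≠ 0 → w ≠ 0 →
            Matrix.mulVec K (fun p : Fin r × Fin r => v p.1 * w p.2) ≠ 0) ∧
          ∀ X : Matrix (Fin r) (Fin r) ℂ, X.det = 0 →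
            Matrix.mulVec (∑ a : Fin r, ∑ b : Fin r, X a b • T a b)
              (Matrix.mulVec K fun p : Fin r × Fin r => X.adjugate p.1 p.2) = 0) := by
  intro hF ε hε
  -- the auxiliary exponent of `costGlue_proof`
  set ε' : ℝ := min ε 1 / 8 with hε'
  have hε'pos : 0 < ε' := by
    have : 0 < min ε 1 := lt_min hε one_pos
    rw [hε']; linarith
  have h8 : 8 * ε' ≤ ε := by
    have : min ε 1 ≤ ε := min_le_left _ _
    rw [hε']; linarith
  have hε'1 : ε' ≤ 1 := by
    have : min ε 1 ≤ 1 := min_le_right _ _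
    rw [hε']; linarith
  have hFam := hF ε' hε'pos
  have hr1 : ∀ᶠ r : ℕ in atTop, 1 ≤ r := eventually_ge_atTop 1
  have hr2 : ∀ᶠ r : ℕ in atTop, (2 : ℝ) ≤ (r : ℝ) ^ (4 * ε') :=
    ((tendsto_rpow_atTop (by linarith : 0 < 4 * ε')).comp
      tendsto_natCast_atTop_atTop).eventually_ge_atTop 2
  refine (hFam.and_eventually (hr1.and hr2)).mono ?_
  rintro r ⟨⟨N, d, hN, hd, T, G₀, H₀, G₁, H₁, hStein, hs, hX₀, K, hK, hker⟩, hr1, hr2⟩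
  have hr1' : (1 : ℝ) ≤ (r : ℝ) := by exact_mod_cast hr1
  -- `N ≤ r³` as naturals (`ε' ≤ 1/8`)
  have hNr3 : N ≤ r ^ 3 := by
    have h3 : (N : ℝ) ≤ (r : ℝ) ^ (3 : ℝ) :=
      hN.trans (Real.rpow_le_rpow_of_exponent_le hr1' (by linarith))
    have h3' : (N : ℝ) ≤ ((r ^ 3 : ℕ) : ℝ) := by
      rw [Nat.cast_pow, ← Real.rpow_natCast]
      exact_mod_cast h3
    exact_mod_cast h3'
  refine ⟨N, d, hNr3, T, G₀, H₀, G₁, H₁, hStein, ?_, hX₀, K, hK, hker⟩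
  -- budget: `d²N + s ≤ (d²N + s)·r^ε' ≤ r^(2+ε)` (name the sparsity `s` first)
  generalize hsdef : ((∑ a : Fin r, ∑ b : Fin r,
      ((Finset.univ.filter fun p : Fin N × Fin d => G₁ a b p.1 p.2 ≠ 0).card +
        (Finset.univ.filter fun p : Fin N × Fin d => H₁ a b p.1 p.2 ≠ 0).card) : ℕ) : ℝ) = s at hs ⊢
  have hs0 : 0 ≤ s := by rw [← hsdef]; exact Nat.cast_nonneg _
  have hdN0 : (0 : ℝ) ≤ (d : ℝ) ^ 2 * (N : ℝ) := mul_nonneg (pow_nonneg (Nat.cast_nonneg d) 2) (Nat.cast_nonneg N)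
  have hc : (d : ℝ) ^ 2 * (N : ℝ) + s ≤ ((d : ℝ) ^ 2 * (N : ℝ) + s) * (r : ℝ) ^ ε' :=
    le_mul_of_one_le_right (add_nonneg hdN0 hs0) (Real.one_le_rpow hr1' hε'pos.le)
  exact costGlue_cost_arith hr1' h8 hr2 (Nat.cast_nonneg N) hN (Nat.cast_nonneg d) hd hs hc

/-- **DEDUP REMARK.** The crux `CheapIdealMember` (stmt-MatrixMultiplication-7708, route
`DeterminantalIdealExponent`: `∃ g ≠ 0, complexity (g · det X) ≤ r^(2+ε)` frequently) and the companion
route's open support item `CheapIdealMembers` (stmt-MatrixMultiplication-7497, route `HiddenToeplitzCorners`: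
`∃ f ≠ 0, det X ∣ f, complexity f ≤ r^(2+ε)` frequently) are the SAME statement: `ℂ[X]` is a domain and
`det X ≠ 0` (`Matrix.det_mvPolynomialX_ne_zero`).  Sorry-free; recorded so that a proof of either item can
be transported to the other by name. [folklore] -/
theorem cheapIdealMember_iff_cheapIdealMembers : CheapIdealMember ↔ CheapIdealMembers := by
  constructor
  · intro h ε hε
    refine (h ε hε).mono ?_
    rintro r ⟨g, hg, hc⟩
    have hdet : detPoly (Fin r) ℂ ≠ 0 := Matrix.det_mvPolynomialX_ne_zero (Fin r) ℂ
    exact ⟨g * detPoly (Fin r) ℂ, mul_ne_zero hg hdet, ⟨g, mul_comm _ _⟩, hc⟩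
  · intro h ε hε
    refine (h ε hε).mono ?_
    rintro r ⟨f, hf, ⟨c, hc⟩, hcost⟩
    refine ⟨c, ?_, ?_⟩
    · rintro rfl
      rw [mul_zero] at hc
      exact hf hc
    · have hcf : c * detPoly (Fin r) ℂ = f := by
        rw [hc, mul_comm]
        rfl
      rw [hcf]
      exact hcost

/-- **THE SKELETON THEOREM (registered form): the crux BY NAME**, fed with the three DECLARED stubs through
`CheapIdealMember_of_stubs` (closed only through their `sorry`s; this is the theorem `ledger skeleton check`
registers and the shape the line's provers discharge stub by stub). [folklore] -/
theorem CheapIdealMember_of : CheapIdealMember :=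
  CheapIdealMember_of_stubs stub_corank_one_step stub_corank_one_dense stub_adjugate_witness

end Summit.MatrixMultiplication.MatrixMultiplication.Cruxes.CheapIdealMember.Birth
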